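import Literature.MathematicalPhysics.QuantumFieldTheory.TorusPlaquetteNeighbours
import HarnessLib

/-!
# Robust ball (Y2), strong-coupling laws — the checkerboard (parity) sparse site set of the torus and its density `1/2`

HONEST FRAMING: venture file of the cell `pub-ymgap` (QuantumFields programme), track ROBUST-BALL, seat rb-p2 (g8).  Pure combinatorics of the
torus `(ℤ/nℤ)^d` (tree `Site d n = Fin d → ZMod n`, `Site.shift`), feeding the energy-variance floor / strong convexity of the free energy
(`EnergyVarianceTorus`, `FreeEnergyStrongConvexity`): a site set of density `→ 1/2` no two of whose sites differ by a unit step in a direction `≠ i`.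
No gauge theory here; nothing about the continuum or Clay.

THE SET.  Fix a direction `i`.  `S = {x : x_k ≠ −1 for all k ≠ i, and Σ_{k ≠ i} val(x_k) is even}` (checkerboard off the `i`-axis, with the last layer
in every transverse direction removed so that no step wraps around).  Then
* `sparse_paritySet` — `x ∈ S ⇒ x + e_k ∉ S` for `k ≠ i` (the transverse parity flips);
* `two_mul_card_paritySet_ge` — `2·|S| ≥ n (n−1)^{d−1}` (sign-sum: `|S| − |S^odd| = n · s^{d−1}` with `s = Σ_{v<n−1} (−1)^v ∈ {0,1}`);
* `tendsto_parity_density`, `parity_density_ge` — `n(n−1)^{d−1}/(2n^d) → 1/2` and `≥ 2^{−d}` for `n ≥ 2`.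
Everything here is proved. [folklore]
-/

noncomputable section

open Finset Function Filter Topology
open Literature.MathematicalPhysics.QuantumFieldTheory

namespace Summit.Ventures.YMGap.RobustBall

namespace EnergyVariance

variable {d : ℕ}

/-- Membership in the transverse layer set `R = univ ∖ {−1}`: `a ≠ (n−1 : ZMod n)` iff `val a ≠ n − 1`. [folklore] -/
theorem mem_erase_last_iff {n : ℕ} [NeZero n] {a : ZMod n} :
    a ∈ (Finset.univ : Finset (ZMod n)).erase (((n - 1 : ℕ) : ZMod n)) ↔ a.val ≠ n - 1 := by
  rw [Finset.mem_erase, and_iff_left (Finset.mem_univ _)]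
  have hlt : n - 1 < n := Nat.sub_lt (NeZero.pos n) one_pos
  constructor
  · intro h hv
    apply h
    have : ((a.val : ℕ) : ZMod n) = ((n - 1 : ℕ) : ZMod n) := by rw [hv]
    simpa [ZMod.natCast_zmod_val] using this
  · intro h hv
    apply h
    rw [hv, ZMod.val_cast_of_lt hlt]

/-- **Sparsity of the parity set**: if `x` has no transverse coordinate equal to `−1` and `k ≠ i`, then the transverse parity of `x + e_k` is the
opposite of that of `x`; hence `x` and `x + e_k` are never both in the parity set. [folklore] -/
theorem sparse_paritySet {n : ℕ} [NeZero n] (hn : 1 < n) (i : Fin d) {x x' : Site d n}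
    (hx : x ∈ (Fintype.piFinset fun k : Fin d => if k = i then (Finset.univ : Finset (ZMod n)) else
        (Finset.univ : Finset (ZMod n)).erase (((n - 1 : ℕ) : ZMod n))).filter
        (fun x => Even (∑ k ∈ Finset.univ.erase i, (x k).val)))
    (hx' : x' ∈ (Fintype.piFinset fun k : Fin d => if k = i then (Finset.univ : Finset (ZMod n)) else
        (Finset.univ : Finset (ZMod n)).erase (((n - 1 : ℕ) : ZMod n))).filter
        (fun x => Even (∑ k ∈ Finset.univ.erase i, (x k).val)))
    (k : Fin d) (hk : k ≠ i) : x' ≠ x.shift k := by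
  haveI : Fact (1 < n) := ⟨hn⟩
  intro h
  rw [Finset.mem_filter, Fintype.mem_piFinset] at hx hx'
  obtain ⟨hxT, hxe⟩ := hx
  obtain ⟨-, hxe'⟩ := hx'
  have hxk : (x k).val ≠ n - 1 := by
    have := hxT k; rw [if_neg hk] at this; exact mem_erase_last_iff.1 this
  have hval : ((x.shift k) k).val = (x k).val + 1 := by
    simp only [Site.shift, Pi.add_apply, Pi.single_eq_same]
    rw [ZMod.val_add, ZMod.val_one, Nat.mod_eq_of_lt]
    have := ZMod.val_lt (x k); omega
  have hother : ∀ k' ∈ (Finset.univ.erase i).erase k, ((x.shift k) k').val = (x k').val := by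
    intro k' hk'
    have hk'k : k' ≠ k := (Finset.mem_erase.1 hk').1
    simp only [Site.shift, Pi.add_apply, Pi.single_eq_of_ne hk'k, add_zero]
  have hkmem : k ∈ Finset.univ.erase i := Finset.mem_erase.2 ⟨hk, Finset.mem_univ _⟩
  have hsum : ∑ k' ∈ Finset.univ.erase i, ((x.shift k) k').val = (∑ k' ∈ Finset.univ.erase i, (x k').val) + 1 := by
    rw [← Finset.add_sum_erase _ _ hkmem, ← Finset.add_sum_erase _ (fun k' => (x k').val) hkmem, hval,
      Finset.sum_congr rfl hother]
    ring
  rw [h, hsum] at hxe'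
  exact (Nat.even_add_one.1 hxe') hxe

/-- **Cardinality of the parity set**: `2·|S| ≥ n·(n−1)^{d−1}` — the even class is at least as large as the odd class (sign-sum
`|S_even| − |S_odd| = n · (Σ_{v<n−1} (−1)^v)^{d−1} ≥ 0`). [folklore] -/
theorem two_mul_card_paritySet_ge {n : ℕ} [NeZero n] (i : Fin d) :
    (n : ℝ) * ((n : ℝ) - 1) ^ (d - 1) ≤ 2 * (((Fintype.piFinset fun k : Fin d => if k = i then (Finset.univ : Finset (ZMod n)) else
        (Finset.univ : Finset (ZMod n)).erase (((n - 1 : ℕ) : ZMod n))).filter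
        (fun x => Even (∑ k ∈ Finset.univ.erase i, (x k).val))).card : ℝ) := by
  classical
  set R : Finset (ZMod n) := (Finset.univ : Finset (ZMod n)).erase (((n - 1 : ℕ) : ZMod n)) with hR
  set t : Fin d → Finset (ZMod n) := fun k => if k = i then (Finset.univ : Finset (ZMod n)) else R with ht
  set T := Fintype.piFinset t with hT
  set par : Site d n → ℕ := fun x => ∑ k ∈ Finset.univ.erase i, (x k).val with hpar
  -- the sign function and its two evaluations
  set σ : Site d n → ℤ := fun x => (-1 : ℤ) ^ par x with hσ
  have hRcard : R.card = n - 1 := by rw [hR, Finset.card_erase_of_mem (Finset.mem_univ _), Finset.card_univ, ZMod.card]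
  have hTcard : T.card = n * (n - 1) ^ (d - 1) := by
    rw [hT, Fintype.card_piFinset]
    have h : ∀ k : Fin d, (t k).card = if k = i then n else n - 1 := by
      intro k; simp only [ht]; split_ifs
      · rw [Finset.card_univ, ZMod.card]
      · exact hRcard
    simp_rw [h]
    rw [Finset.prod_ite, Finset.prod_const, Finset.prod_const]
    have h1 : (Finset.univ.filter fun k : Fin d => k = i).card = 1 := by
      rw [Finset.filter_eq', if_pos (Finset.mem_univ _), Finset.card_singleton]
    have h2 : (Finset.univ.filter fun k : Fin d => ¬k = i).card = d - 1 := by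
      rw [Finset.filter_ne' Finset.univ i, Finset.card_erase_of_mem (Finset.mem_univ _), Finset.card_univ, Fintype.card_fin]
    rw [h1, h2, pow_one]
  -- sign-sum = #even − #odd
  have hsplit : (∑ x ∈ T, σ x) = ((T.filter fun x => Even (par x)).card : ℤ) - ((T.filter fun x => ¬Even (par x)).card : ℤ) := by
    rw [← Finset.sum_filter_add_sum_filter_not T (fun x => Even (par x))]
    have he : ∀ x ∈ T.filter (fun x => Even (par x)), σ x = 1 := fun x hx => by
      simp only [hσ]; exact Even.neg_one_pow (Finset.mem_filter.1 hx).2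
    have ho : ∀ x ∈ T.filter (fun x => ¬Even (par x)), σ x = -1 := fun x hx => by
      simp only [hσ]; exact Odd.neg_one_pow (Nat.not_even_iff_odd.1 (Finset.mem_filter.1 hx).2)
    rw [Finset.sum_congr rfl he, Finset.sum_congr rfl ho, Finset.sum_const, Finset.sum_const]
    simp [sub_eq_add_neg]
  -- sign-sum = n · s^{d-1} ≥ 0 via the product formula
  set f : (k : Fin d) → ZMod n → ℤ := fun k a => if k = i then 1 else (-1 : ℤ) ^ a.val with hf
  have hσprod : ∀ x ∈ T, σ x = ∏ k, f k (x k) := by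
    intro x _
    simp only [hσ, hpar]
    rw [← Finset.mul_prod_erase Finset.univ (fun k => f k (x k)) (Finset.mem_univ i)]
    simp only [hf, if_true, one_mul]
    rw [Finset.prod_congr rfl fun k hk => if_neg (Finset.mem_erase.1 hk).1, Finset.prod_pow_eq_pow_sum]
  have hs0 : 0 ≤ ∑ a ∈ R, (-1 : ℤ) ^ a.val := by
    have himg : R.image (fun a : ZMod n => a.val) = Finset.range (n - 1) := by
      ext v
      rw [Finset.mem_image, Finset.mem_range]
      constructor
      · rintro ⟨a, ha, rfl⟩
        have h1 := mem_erase_last_iff.1 ha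
        have h2 := ZMod.val_lt a
        omega
      · intro hv
        refine ⟨((v : ℕ) : ZMod n), mem_erase_last_iff.2 ?_, ?_⟩
        · rw [ZMod.val_cast_of_lt (by omega)]; omega
        · exact ZMod.val_cast_of_lt (by omega)
    rw [← Finset.sum_image (f := fun v : ℕ => (-1 : ℤ) ^ v) fun a _ b _ h => ZMod.val_injective n h, himg, neg_one_geom_sum]
    split_ifs <;> norm_num
  have hsum : (∑ x ∈ T, σ x) = (n : ℤ) * (∑ a ∈ R, (-1 : ℤ) ^ a.val) ^ (d - 1) := by
    rw [Finset.sum_congr rfl hσprod, hT, ← Finset.prod_univ_sum]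
    have h : ∀ k : Fin d, (∑ a ∈ t k, f k a) = if k = i then (n : ℤ) else ∑ a ∈ R, (-1 : ℤ) ^ a.val := by
      intro k
      simp only [ht, hf]
      split_ifs with hki
      · simp [ZMod.card]
      · rfl
    simp_rw [h]
    rw [Finset.prod_ite, Finset.prod_const, Finset.prod_const]
    have h1 : (Finset.univ.filter fun k : Fin d => k = i).card = 1 := by
      rw [Finset.filter_eq', if_pos (Finset.mem_univ _), Finset.card_singleton]
    have h2 : (Finset.univ.filter fun k : Fin d => ¬k = i).card = d - 1 := by
      rw [Finset.filter_ne' Finset.univ i, Finset.card_erase_of_mem (Finset.mem_univ _), Finset.card_univ, Fintype.card_fin]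
    rw [h1, h2, pow_one]
  have hnonneg : 0 ≤ ∑ x ∈ T, σ x := by rw [hsum]; positivity
  -- conclude
  have htot : ((T.filter fun x => Even (par x)).card : ℤ) + ((T.filter fun x => ¬Even (par x)).card : ℤ) = (T.card : ℤ) := by
    exact_mod_cast Finset.card_filter_add_card_filter_not (fun x => Even (par x))
  have hE : (n * (n - 1) ^ (d - 1) : ℕ) ≤ 2 * (T.filter fun x => Even (par x)).card := by
    rw [← hTcard]
    have := hsplit ▸ hnonneg
    omega
  have hcast : ((n * (n - 1) ^ (d - 1) : ℕ) : ℝ) ≤ 2 * ((T.filter fun x => Even (par x)).card : ℝ) := by exact_mod_cast hE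
  refine le_trans (le_of_eq ?_) hcast
  rcases Nat.eq_zero_or_pos n with hn | hn
  · subst hn; simp
  · push_cast [Nat.cast_sub hn]; ring

/-- **Density of the parity set**: `n(n−1)^{d−1}/(2 n^d) → 1/2` along `n = L + 1 → ∞` (`d ≥ 1`). [folklore] -/
theorem tendsto_parity_density (hd : 1 ≤ d) :
    Tendsto (fun L : ℕ => (((L + 1 : ℕ) : ℝ) * (((L + 1 : ℕ) : ℝ) - 1) ^ (d - 1)) / (2 * ((L + 1 : ℕ) : ℝ) ^ d)) atTop
      (𝓝 (1 / 2 : ℝ)) := by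
  obtain ⟨e, he⟩ : ∃ e, d = e + 1 := ⟨d - 1, by omega⟩
  subst he
  simp only [Nat.add_sub_cancel]
  have hre : ∀ L : ℕ, (((L + 1 : ℕ) : ℝ) * (((L + 1 : ℕ) : ℝ) - 1) ^ e) / (2 * ((L + 1 : ℕ) : ℝ) ^ (e + 1)) =
      (1 / 2 : ℝ) * (1 - (((L + 1 : ℕ) : ℝ))⁻¹) ^ e := by
    intro L
    have hn : ((L + 1 : ℕ) : ℝ) ≠ 0 := by positivity
    rw [pow_succ', show (1 : ℝ) - (((L + 1 : ℕ) : ℝ))⁻¹ = ((((L + 1 : ℕ) : ℝ) - 1) / ((L + 1 : ℕ) : ℝ)) by field_simp, div_pow]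
    field_simp
  simp_rw [hre]
  have h1 : Tendsto (fun L : ℕ => ((L + 1 : ℕ) : ℝ)) atTop atTop := tendsto_natCast_atTop_atTop.comp (tendsto_add_atTop_nat 1)
  have h2 : Tendsto (fun L : ℕ => (((L + 1 : ℕ) : ℝ))⁻¹) atTop (𝓝 0) := h1.inv_tendsto_atTop
  have h3 : Tendsto (fun L : ℕ => (1 : ℝ) - (((L + 1 : ℕ) : ℝ))⁻¹) atTop (𝓝 1) := by
    have := (tendsto_const_nhds (x := (1 : ℝ)) (f := (atTop : Filter ℕ))).sub h2
    rw [sub_zero] at this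
    exact this
  have h4 := (h3.pow e).const_mul (1 / 2 : ℝ)
  rw [one_pow, mul_one] at h4
  exact h4

/-- **Uniform density bound**: for `L ≥ 1` (`n = L + 1 ≥ 2`), `n(n−1)^{d−1}/(2n^d) ≥ 2^{−d}` (`d ≥ 1`). [folklore] -/
theorem parity_density_ge (hd : 1 ≤ d) {L : ℕ} (hL : 1 ≤ L) :
    (1 / 2 : ℝ) ^ d ≤ (((L + 1 : ℕ) : ℝ) * (((L + 1 : ℕ) : ℝ) - 1) ^ (d - 1)) / (2 * ((L + 1 : ℕ) : ℝ) ^ d) := by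
  obtain ⟨e, he⟩ : ∃ e, d = e + 1 := ⟨d - 1, by omega⟩
  subst he
  simp only [Nat.add_sub_cancel]
  have hn : (0 : ℝ) < ((L + 1 : ℕ) : ℝ) := by positivity
  have hre : (((L + 1 : ℕ) : ℝ) * (((L + 1 : ℕ) : ℝ) - 1) ^ e) / (2 * ((L + 1 : ℕ) : ℝ) ^ (e + 1)) =
      (1 / 2 : ℝ) * ((((L + 1 : ℕ) : ℝ) - 1) / ((L + 1 : ℕ) : ℝ)) ^ e := by
    rw [pow_succ', div_pow]
    field_simp
  rw [hre, pow_succ']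
  refine mul_le_mul_of_nonneg_left (pow_le_pow_left₀ (by norm_num) ?_ e) (by norm_num)
  rw [le_div_iff₀ hn]
  have : (2 : ℝ) ≤ ((L + 1 : ℕ) : ℝ) := by exact_mod_cast (show 2 ≤ L + 1 by omega)
  linarith

end EnergyVariance

end Summit.Ventures.YMGap.RobustBall
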